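import Summits.NavierStokesRegularity.NavierStokesRegularity.Theorems.AxisTwistDoorAveragedConeLiouvilleNUWeakEnergyTools
import HarnessLib

/-!
# N4 / T1 piece W1a: the time-weighted energy inequality of a LIPSCHITZ generalized supersolution
# of `∂ₜV − ΔV + b·∇V ≥ 0` (Nazarov–Ural'tseva 2011, the computation behind (3.2)/(3.9) for the
# generalized solutions of p. 2–3 / p. 8), BEFORE the divergence-free transfer

Route `AxisTwistDoor`, crux `AveragedConeLiouville` (stmt-NavierStokesRegularity-26889), INPUT N4 / T1
(the typed fact `Literature.Analysis.FluidPDE.NazarovUraltseva2011_positivity_propagation (ℝ³)`),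
programme `kits/N4-T1-skeleton.lean` (118454bf17607d1e), piece W1 (`Sig.nu_weakEnergyIdentity`);
this file opens its first brick W1a (work plan `kits/N4-T1-W1-handoff.md`) with the ADMISSIBILITY of the
Nazarov–Ural'tseva test function `−H'(V)Θ²c`; the target inequality of W1a reads: for the weak data of the
typed fact — `V` Lipschitz on the open cylinder `]0,T[ × B(0,1)`, `b` measurable and bounded there, the
integral supersolution inequality against every nonnegative Lipschitz test vanishing near the
lateral boundary and the bottom — and for `H ∈ C²` with `H' ≤ 0`, a cut-off `Θ ∈ C¹`,
`tsupport Θ ⊆ B(0,ρ₀)`, `ρ₀ < 1`, and a Lipschitz time weight `c ≥ 0` vanishing outside `]τ₀, T₀[`,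
`0 < τ₀`, `T₀ < T`:
`∫ c H''(V)|∇V|²Θ² ≤ ∫ c' H(V)Θ² − ∫ c H'(V)⟪∇V,∇Θ²⟫ − ∫ c Θ² H'(V)⟪b,∇V⟫` (integrals over the cylinder).
Proof: the test `η = −H'(V)Θ²c` is admissible (Lipschitz by `lipschitzWith_mul_of_eq_zero_off`, the
first factor being controlled only on the compact `[τ₀,T₀] × B̄(0,ρ₀)`); the integrand of the weak
inequality is computed a.e. by Rademacher (`LipschitzWith.ae_differentiableAt`) through the slice
tools; the time term is integrated by parts with `integral_timeDeriv_mul_eq_neg`.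

WHAT THIS IS NOT: not a statement about Navier–Stokes; T1 is an INPUT; item 26889 and the summit
stay open. [cite: NazarovUraltseva2011HarnackDivFree, §1 p. 2–3, §3 (3.2) (arXiv:1011.1888 p. 8)]
-/

noncomputable section

-- the summit and its single sub-problem share the name (CONVENTIONS §1)
set_option linter.dupNamespace false

open MeasureTheory Set Function Filter Topology Metric
open scoped NNReal ENNReal InnerProductSpace RealInnerProductSpace

namespace Summit.NavierStokesRegularity.NavierStokesRegularity.Theorems.AveragedConeLiouville.NUPositivity

/-- **Admissibility of the Nazarov–Ural'tseva test function.** For `g : ℝ × ℝ³ → ℝ` Lipschitz,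
`H' ∈ C¹`, `Θ ∈ C¹` with `tsupport Θ ⊆ B(0,ρ₀)`, and a Lipschitz time weight `c` vanishing on
`]−∞,τ₀] ∪ [T₀,∞[`, the function `(t,x) ↦ −H'(g(t,x))·Θ(x)²·c(t)` is (globally) Lipschitz. [folklore] -/
theorem exists_lipschitzWith_test {g : ℝ × EuclideanSpace ℝ (Fin 3) → ℝ} {L : ℝ≥0}
    (hg : LipschitzWith L g) {H' : ℝ → ℝ} (hH' : ContDiff ℝ 1 H')
    {Θ : EuclideanSpace ℝ (Fin 3) → ℝ} (hΘ : ContDiff ℝ 1 Θ) (hΘc : HasCompactSupport Θ) {ρ₀ : ℝ}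
    (hΘρ : tsupport Θ ⊆ ball (0 : EuclideanSpace ℝ (Fin 3)) ρ₀)
    {c : ℝ → ℝ} {Kc : ℝ≥0} (hc : LipschitzWith Kc c) {τ₀ T₀ : ℝ}
    (hcτ : ∀ t, t ≤ τ₀ → c t = 0) (hcT : ∀ t, T₀ ≤ t → c t = 0) :
    ∃ K : ℝ≥0, LipschitzWith K (uncurry fun t x => -H' (g (t, x)) * (Θ x ^ 2 * c t)) := by
  -- the compact set `K = [τ₀,T₀] × B̄(0,ρ₀)` off which the second factor vanishes
  set K : Set (ℝ × EuclideanSpace ℝ (Fin 3)) := Icc τ₀ T₀ ×ˢ closedBall (0 : EuclideanSpace ℝ (Fin 3)) ρ₀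
    with hK
  have hKc : IsCompact K := isCompact_Icc.prod (isCompact_closedBall _ _)
  -- the second factor `G(t,x) = Θ(x)² c(t)`: Lipschitz, bounded, zero off `K`
  have hΘ2 : ContDiff ℝ 1 fun y => Θ y ^ 2 := hΘ.pow 2
  have hΘ2c : HasCompactSupport fun y => Θ y ^ 2 := by
    have e : (fun y => Θ y ^ 2) = fun y => Θ y * Θ y := funext fun y => pow_two _
    rw [e]; exact hΘc.mul_left
  obtain ⟨CΘ, hCΘ⟩ := ContDiff.lipschitzWith_of_hasCompactSupport hΘ2c hΘ2 one_ne_zero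
  obtain ⟨BΘ, hBΘ⟩ := hΘ2c.exists_bound_of_continuous hΘ2.continuous
  have hBΘ0 : 0 ≤ BΘ := (norm_nonneg _).trans (hBΘ 0)
  obtain ⟨Bc₀, hBc₀⟩ := isCompact_Icc.exists_bound_of_continuousOn
    (hc.continuous.continuousOn (s := Icc τ₀ T₀))
  set Bc : ℝ := max Bc₀ 0 with hBc
  have hBc0 : 0 ≤ Bc := le_max_right _ _
  have hcb : ∀ t, |c t| ≤ Bc := by
    intro t
    by_cases ht : t ∈ Icc τ₀ T₀
    · exact ((Real.norm_eq_abs _).symm.le.trans (hBc₀ t ht)).trans (le_max_left _ _)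
    · have : c t = 0 := by
        rcases not_and_or.mp (show ¬ (τ₀ ≤ t ∧ t ≤ T₀) from ht) with h | h
        · exact hcτ t (le_of_lt (not_le.mp h))
        · exact hcT t (le_of_lt (not_le.mp h))
      rw [this, abs_zero]; exact hBc0
  have hGlip : LipschitzWith (⟨BΘ, hBΘ0⟩ * (Kc * 1) + ⟨Bc, hBc0⟩ * (CΘ * 1))
      (fun p : ℝ × EuclideanSpace ℝ (Fin 3) => Θ p.2 ^ 2 * c p.1) := by
    refine lipschitzWith_mul_of_eq_zero_off (K := (univ : Set (ℝ × EuclideanSpace ℝ (Fin 3))))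
      (hc.comp LipschitzWith.prod_fst) (fun p => hcb p.1) (fun p hp => absurd (mem_univ p) hp)
      ((hCΘ.comp LipschitzWith.prod_snd).lipschitzOnWith) (fun p _ => ?_) hBΘ0 hBc0
    exact (Real.norm_eq_abs _).symm.le.trans (hBΘ p.2)
  have hGb : ∀ p : ℝ × EuclideanSpace ℝ (Fin 3), |Θ p.2 ^ 2 * c p.1| ≤ BΘ * Bc := fun p => by
    rw [abs_mul]
    exact mul_le_mul ((Real.norm_eq_abs _).symm.le.trans (hBΘ p.2)) (hcb p.1) (abs_nonneg _) hBΘ0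
  have hG0 : ∀ p : ℝ × EuclideanSpace ℝ (Fin 3), p ∉ K → Θ p.2 ^ 2 * c p.1 = 0 := by
    intro p hp
    rcases not_and_or.mp (show ¬ (p.1 ∈ Icc τ₀ T₀ ∧ p.2 ∈ closedBall (0 : EuclideanSpace ℝ (Fin 3)) ρ₀)
      from fun h => hp ⟨h.1, h.2⟩) with h | h
    · have : c p.1 = 0 := by
        rcases not_and_or.mp (show ¬ (τ₀ ≤ p.1 ∧ p.1 ≤ T₀) from h) with h' | h'
        · exact hcτ _ (le_of_lt (not_le.mp h'))
        · exact hcT _ (le_of_lt (not_le.mp h'))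
      rw [this, mul_zero]
    · have hΘ0 : Θ p.2 = 0 := by
        refine image_eq_zero_of_notMem_tsupport fun h' => h ?_
        exact ball_subset_closedBall (hΘρ h')
      rw [hΘ0]; ring
  -- the first factor `F = −H' ∘ g`: Lipschitz and bounded ON `K`
  obtain ⟨Mg, hMg⟩ := hKc.exists_bound_of_continuousOn (hg.continuous.continuousOn (s := K))
  have hmaps : MapsTo g K (Icc (-Mg) Mg) := fun p hp =>
    abs_le.mp ((Real.norm_eq_abs _).symm.le.trans (hMg p hp))
  have hnegH : ContDiff ℝ 1 fun v => -H' v := hH'.neg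
  obtain ⟨KH, hKH⟩ := hnegH.contDiffOn.exists_lipschitzOnWith one_ne_zero (convex_Icc (-Mg) Mg)
    isCompact_Icc
  have hFlip : LipschitzOnWith (KH * L) (fun p : ℝ × EuclideanSpace ℝ (Fin 3) => -H' (g p)) K :=
    hKH.comp hg.lipschitzOnWith hmaps
  obtain ⟨MF, hMF⟩ := isCompact_Icc.exists_bound_of_continuousOn
    (hnegH.continuous.continuousOn (s := Icc (-Mg) Mg))
  have hMF0 : 0 ≤ max MF 0 := le_max_right _ _
  have hFb : ∀ p ∈ K, |(-H' (g p))| ≤ max MF 0 := fun p hp =>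
    ((Real.norm_eq_abs _).symm.le.trans (hMF _ (hmaps hp))).trans (le_max_left _ _)
  have hBG0 : 0 ≤ BΘ * Bc := mul_nonneg hBΘ0 hBc0
  refine ⟨_, lipschitzWith_mul_of_eq_zero_off hGlip hGb hG0 hFlip hFb hMF0 hBG0⟩

end Summit.NavierStokesRegularity.NavierStokesRegularity.Theorems.AveragedConeLiouville.NUPositivity

end
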